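import Literature.Probability.LatticeModels.BattleFederbushWeights
import Literature.MeasureTheory.Integral.PolynomialCubeIntegral
import Mathlib.Analysis.Calculus.ContDiff.Basic
import Mathlib.Analysis.Calculus.Deriv.Pi
import Mathlib.Analysis.Calculus.Deriv.Mul
import Mathlib.Analysis.Calculus.Deriv.Comp
import Mathlib.Analysis.Calculus.Deriv.Add
import Mathlib.Analysis.Normed.Operator.BoundedLinearMaps
import Mathlib.MeasureTheory.Integral.IntervalIntegral.FundThmCalculus
import Mathlib.MeasureTheory.Integral.Prod

/-!
# Crux `AnchorGap` (stmt-QuantumFields-11141), line `registered` — analytic peeling formula, tools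

Generic analysis used by the analytic Battle–Brydges–Federbush peeling formula
(`SmallCircleAnchorAnchorGapBBFPeelingAnalytic.lean`):

* `eval_substAt` — evaluating `P|_{t_v = c}` is evaluating `P` at the updated point;
* `hasDerivAt_eval_update` — the derivative of `θ ↦ P(t[v := θ])` is `(∂_v P)(t[v := θ])`;
* `measurePreserving_update`, `setIntegral_unitCube_eq_integral_update` — integrating out one
  coordinate of the unit cube: `∫_{[0,1]^ι} Φ = ∫_{[0,1]^ι} (∫₀¹ Φ(t[v := θ]) dθ) dt`;
* `clm_apply_eq_sum_single` — a linear functional on `σ → ℝ` expanded along `Pi.single`;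
* `contDiffOn_foldl_dirDeriv` — iterated directional derivatives `L.foldl (g ℓ ↦ ∂_ℓ g) f` along a
  list of coordinate directions of a smooth function on an open set are smooth there.

Everything is proved; no definition and no named fact is introduced. [folklore]
-/

set_option autoImplicit false

noncomputable section

namespace Summit.QuantumFields.YangMills.Theorems.AnchorGap

namespace BBFPeel

open MeasureTheory MvPolynomial Literature.RingTheory.MvPolynomial Literature.MeasureTheory.Integral

/-! ### Polynomial substitution and one-variable derivatives -/

/-- Evaluating the substitution `t_v ↦ c` of a polynomial at `t` is evaluating the polynomial at
`t[v := c]`. [folklore] -/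
theorem eval_substAt {ι : Type*} [DecidableEq ι] {R : Type*} [CommRing R] (t : ι → R) (v : ι) (c : R)
    (P : MvPolynomial ι R) : eval t (substAt v c P) = eval (Function.update t v c) P := by
  have h : (eval t).comp (substAt v c : MvPolynomial ι R →ₐ[R] MvPolynomial ι R).toRingHom =
      eval (Function.update t v c) := by
    refine MvPolynomial.ringHom_ext (fun a => ?_) (fun i => ?_)
    · simp [substAt]
    · by_cases hi : i = v
      · subst hi
        simp [substAt_X_self]
      · simp [substAt_X_of_ne hi, Function.update_of_ne hi]
  exact RingHom.congr_fun h P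

/-- The derivative of `θ ↦ P(t[v := θ])` at `θ` is `(∂_v P)(t[v := θ])`. [folklore] -/
theorem hasDerivAt_eval_update {ι : Type*} [DecidableEq ι] (P : MvPolynomial ι ℝ) (t : ι → ℝ) (v : ι)
    (θ : ℝ) :
    HasDerivAt (fun τ => eval (Function.update t v τ) P) (eval (Function.update t v θ) (pderiv v P)) θ := by
  induction P using MvPolynomial.induction_on with
  | C a => simpa using hasDerivAt_const θ a
  | add p q hp hq =>
    have := hp.fun_add hq
    simpa only [map_add] using this
  | mul_X p i hp =>
    by_cases hiv : i = v
    · subst hiv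
      have h3 := hp.fun_mul (hasDerivAt_id' θ)
      have hval : eval (Function.update t i θ) (pderiv i p) * θ + eval (Function.update t i θ) p * 1 =
          eval (Function.update t i θ) (pderiv i (p * X i)) := by
        simp only [Derivation.leibniz, pderiv_X_self, smul_eq_mul, mul_one, map_add, map_mul, eval_X,
          Function.update_self]
        ring
      have hfun : (fun τ : ℝ => eval (Function.update t i τ) (p * X i)) =
          fun τ => eval (Function.update t i τ) p * τ := by
        funext τ
        rw [map_mul, eval_X, Function.update_self]
      rw [hval] at h3
      rw [hfun]
      exact h3
    · have h3 := hp.mul_const (t i)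
      have hval : eval (Function.update t v θ) (pderiv v p) * t i =
          eval (Function.update t v θ) (pderiv v (p * X i)) := by
        simp only [Derivation.leibniz, pderiv_X_of_ne hiv, smul_eq_mul, mul_zero, zero_add, map_mul, eval_X,
          Function.update_of_ne hiv]
        ring
      have hfun : (fun τ : ℝ => eval (Function.update t v τ) (p * X i)) =
          fun τ => eval (Function.update t v τ) p * t i := by
        funext τ
        rw [map_mul, eval_X, Function.update_of_ne hiv]
      rw [hval] at h3
      rw [hfun]
      exact h3

/-! ### Integrating out one coordinate of the unit cube -/

/-- For a measure `μ` of total mass one on `ℝ`, the map `(t, θ) ↦ t[v := θ]` pushes `μ^{⊗ι} ⊗ μ`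
forward to `μ^{⊗ι}`. [folklore] -/
theorem measurePreserving_update {ι : Type*} [Fintype ι] [DecidableEq ι] (μ : Measure ℝ) [SigmaFinite μ]
    (hμ : μ Set.univ = 1) (v : ι) :
    MeasurePreserving (fun p : (ι → ℝ) × ℝ => Function.update p.1 v p.2)
      ((Measure.pi fun _ : ι => μ).prod μ) (Measure.pi fun _ : ι => μ) := by
  refine ⟨measurable_update', (Measure.pi_eq fun s hs => ?_).symm⟩
  rw [Measure.map_apply measurable_update' (MeasurableSet.univ_pi hs)]
  have hpre : (fun p : (ι → ℝ) × ℝ => Function.update p.1 v p.2) ⁻¹' Set.univ.pi s =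
      (Set.univ.pi (Function.update s v Set.univ)) ×ˢ s v := by
    ext ⟨t, τ⟩
    simp only [Set.mem_preimage, Set.mem_univ_pi, Set.mem_prod]
    rw [Function.forall_update_iff t fun i x => x ∈ s i,
      Function.forall_update_iff s fun i S => t i ∈ S]
    simp only [Set.mem_univ, true_and]
    tauto
  rw [hpre, Measure.prod_prod, Measure.pi_pi]
  have h1 : ∀ i, μ (Function.update s v Set.univ i) = Function.update (fun i => μ (s i)) v (μ Set.univ) i :=
    fun i => Function.apply_update (fun _ S => μ S) s v Set.univ i
  rw [Finset.prod_congr rfl fun i _ => h1 i, Finset.prod_update_of_mem (Finset.mem_univ v), hμ, one_mul,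
    Finset.prod_eq_mul_prod_sdiff_singleton_of_mem (Finset.mem_univ v) (fun i => μ (s i)), mul_comm]

/-- **Integrating out one coordinate of the unit cube**: for `Φ` integrable on `[0,1]^ι` and a
coordinate `v`, `∫_{[0,1]^ι} Φ(t) dt = ∫_{[0,1]^ι} (∫₀¹ Φ(t[v := θ]) dθ) dt`. [folklore] -/
theorem setIntegral_unitCube_eq_integral_update {ι : Type*} [Fintype ι] [DecidableEq ι]
    (Φ : (ι → ℝ) → ℝ) (hΦ : IntegrableOn Φ (unitCube ι)) (v : ι) :
    ∫ t in unitCube ι, Φ t = ∫ t in unitCube ι, ∫ θ in (0 : ℝ)..1, Φ (Function.update t v θ) := by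
  set μ : Measure ℝ := volume.restrict (Set.Icc (0 : ℝ) 1) with hμ
  have hμ1 : μ Set.univ = 1 := by
    rw [hμ, Measure.restrict_apply_univ, Real.volume_Icc, sub_zero, ENNReal.ofReal_one]
  have hcube : (volume : Measure (ι → ℝ)).restrict (unitCube ι) = Measure.pi fun _ : ι => μ := by
    rw [unitCube, volume_pi, Measure.restrict_pi_pi]
  have hmp := measurePreserving_update μ hμ1 v
  rw [IntegrableOn, hcube] at hΦ
  have hinner : ∀ t : ι → ℝ, ∫ θ in (0 : ℝ)..1, Φ (Function.update t v θ) =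
      ∫ θ, Φ (Function.update t v θ) ∂μ := by
    intro t
    rw [intervalIntegral.integral_of_le zero_le_one, ← integral_Icc_eq_integral_Ioc]
  simp_rw [hinner]
  rw [hcube]
  have hae : AEStronglyMeasurable Φ
      (Measure.map (fun p : (ι → ℝ) × ℝ => Function.update p.1 v p.2) ((Measure.pi fun _ : ι => μ).prod μ)) := by
    rw [hmp.map_eq]
    exact hΦ.aestronglyMeasurable
  calc ∫ t, Φ t ∂(Measure.pi fun _ : ι => μ)
      = ∫ p, Φ (Function.update p.1 v p.2) ∂((Measure.pi fun _ : ι => μ).prod μ) := by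
        rw [← integral_map measurable_update'.aemeasurable hae, hmp.map_eq]
    _ = ∫ t, ∫ θ, Φ (Function.update t v θ) ∂μ ∂(Measure.pi fun _ : ι => μ) :=
        integral_prod (fun p : (ι → ℝ) × ℝ => Φ (Function.update p.1 v p.2))
          ((integrable_map_measure hae measurable_update'.aemeasurable).1 (by rw [hmp.map_eq]; exact hΦ))

/-! ### Linear functionals along coordinate vectors -/

/-- A linear functional on `σ → ℝ` expanded along the coordinate vectors:
`A x = Σ_i x_i · A e_i`. [folklore] -/
theorem clm_apply_eq_sum_single {σ : Type*} [Fintype σ] [DecidableEq σ] (A : (σ → ℝ) →L[ℝ] ℝ) (x : σ → ℝ) :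
    A x = ∑ i, x i * A (Pi.single i 1) := by
  conv_lhs => rw [← Finset.univ_sum_single x]
  rw [map_sum]
  refine Finset.sum_congr rfl fun i _ => ?_
  rw [← smul_eq_mul, ← ContinuousLinearMap.map_smul, ← Pi.single_smul', smul_eq_mul, mul_one]

/-! ### Iterated directional derivatives -/

/-- Appending a last direction to an iterated directional derivative
`L.foldl (g ℓ ↦ ∂_ℓ g) f` (first entry of the list innermost). [folklore] -/
theorem foldl_dirDeriv_append_singleton {σ : Type*} [Fintype σ] [DecidableEq σ] (L : List σ) (ℓ : σ)
    (f : (σ → ℝ) → ℝ) :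
    (L ++ [ℓ]).foldl (fun (g : (σ → ℝ) → ℝ) (i : σ) => fun x : σ → ℝ => fderiv ℝ g x (Pi.single i 1)) f =
      fun x => fderiv ℝ (L.foldl (fun (g : (σ → ℝ) → ℝ) (i : σ) => fun x : σ → ℝ => fderiv ℝ g x (Pi.single i 1)) f) x
        (Pi.single ℓ 1) := by
  rw [List.foldl_append]
  rfl

/-- A directional derivative of a smooth function on an open set is smooth there. [folklore] -/
theorem contDiffOn_dirDeriv {σ : Type*} [Fintype σ] [DecidableEq σ] {U : Set (σ → ℝ)} (hU : IsOpen U)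
    {g : (σ → ℝ) → ℝ} (hg : ContDiffOn ℝ (⊤ : ℕ∞) g U) (ℓ : σ) :
    ContDiffOn ℝ (⊤ : ℕ∞) (fun x => fderiv ℝ g x (Pi.single ℓ 1)) U :=
  ((contDiffOn_infty_iff_fderiv_of_isOpen hU).1 hg).2.clm_apply contDiffOn_const

/-- Iterated directional derivatives `L.foldl (g ℓ ↦ ∂_ℓ g) f` of a smooth function on an open set are
smooth there. [folklore] -/
theorem contDiffOn_foldl_dirDeriv {σ : Type*} [Fintype σ] [DecidableEq σ] {U : Set (σ → ℝ)} (hU : IsOpen U) :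
    ∀ (L : List σ) {f : (σ → ℝ) → ℝ}, ContDiffOn ℝ (⊤ : ℕ∞) f U →
      ContDiffOn ℝ (⊤ : ℕ∞) (L.foldl (fun (g : (σ → ℝ) → ℝ) (i : σ) => fun x : σ → ℝ => fderiv ℝ g x (Pi.single i 1)) f) U
  | [], _, hf => hf
  | ℓ :: L, _, hf => contDiffOn_foldl_dirDeriv hU L (contDiffOn_dirDeriv hU hf ℓ)

end BBFPeel

end Summit.QuantumFields.YangMills.Theorems.AnchorGap
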